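import Literature.NumberTheory.LFunctions.DirichletPolynomialMeanValueThm52
import HarnessLib

/-!
# The bilinear mean value theorem for Dirichlet polynomials (polarised Montgomery–Vaughan)

Topic `Literature/NumberTheory/LFunctions`. Everything in this file is PROVED (no definitions, no
named facts).

From the tree's mean value theorem for Dirichlet polynomials with explicit constant
(`Literature.NumberTheory.LFunctions.integral_norm_sq_dirichletPoly_sub_le`, Ivić 1985 Thm 5.2 /
Montgomery–Vaughan 1974: `|∫_0^T |∑_{n ≤ N} a_n n^{it}|² dt − T ∑ |a_n|²| ≤ 928 ∑ n|a_n|²` for all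
real `T`) we derive, by the polarisation identity
`4 x ȳ = |x+y|² − |x−y|² + i|x+iy|² − i|x−iy|²`, the **bilinear** form on an arbitrary interval:

* `Literature.NumberTheory.LFunctions.norm_integral_dirichletPoly_mul_conj_sub_le` — for complex
  `a_n, b_n` (`1 ≤ n ≤ N`) and real `T₁, T₂`,
  `‖∫_{T₁}^{T₂} (∑ a_n n^{it}) conj(∑ b_n n^{it}) dt − (T₂ − T₁) ∑ a_n b̄_n‖ ≤ 3712 ∑_{n ≤ N} n (|a_n|² + |b_n|²)`.

This is the form in which the mean value theorem enters Titchmarsh's Lemma 9.21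
(`∫_T^{T+U} z₁(t) z̄₁(t) (n/m)^{it} dt = U (mn)^{-1/2} ∑_{r ≤ τ/M} 1/r + O(T^{1/2} M² log(MT))`, with
`z₁ z̄₁ (n/m)^{it}` the product of the two Dirichlet polynomials `∑_μ μ^{-1/2} (mμ)^{-it}` and
`∑_ν ν^{-1/2} (nν)^{-it}` on the common frequency set `k ≤ Mτ`); the present error term
`O(∑ k(|a_k|² + |b_k|²)) = O(Mτ)` is sharper than the printed one.

## References

* A. Ivić, *The Riemann Zeta-Function* (1985), Thm 5.2. [cite: Ivic1985, Theorem 5.2]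
* H. L. Montgomery, R. C. Vaughan, *Hilbert's inequality*, J. London Math. Soc. (2) 8 (1974) 73–82.
* E. C. Titchmarsh, *The Theory of the Riemann Zeta-Function*, 2nd ed. (1986), §7.2 and Lemma 9.21.
-/

noncomputable section

open Finset Real MeasureTheory Complex intervalIntegral
open scoped ComplexConjugate

namespace Literature.NumberTheory.LFunctions

/-- **Polarisation**: `4 x ȳ = |x+y|² − |x−y|² + i|x+iy|² − i|x−iy|²`. [folklore] -/
theorem four_mul_mul_conj_eq_polarisation (x y : ℂ) :
    4 * (x * conj y) = ((‖x + y‖ ^ 2 : ℝ) : ℂ) - ((‖x - y‖ ^ 2 : ℝ) : ℂ)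
      + I * ((‖x + I * y‖ ^ 2 : ℝ) : ℂ) - I * ((‖x - I * y‖ ^ 2 : ℝ) : ℂ) := by
  have h : ∀ z : ℂ, ((‖z‖ ^ 2 : ℝ) : ℂ) = z * conj z := fun z => by
    rw [Complex.mul_conj, Complex.normSq_eq_norm_sq, Complex.ofReal_pow]
  simp only [h, map_add, map_sub, map_mul, Complex.conj_I]
  linear_combination (2 * (x * conj y - y * conj x)) * Complex.I_sq

/-- The phase `t ↦ n^{it}` is continuous for `n ≥ 1`. [folklore] -/
theorem continuous_natCast_cpow_mul_I {n : ℕ} (hn : n ≠ 0) :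
    Continuous fun t : ℝ => (n : ℂ) ^ ((t : ℂ) * I) :=
  Continuous.const_cpow (by fun_prop) (Or.inl (by exact_mod_cast hn))

/-- A Dirichlet polynomial `t ↦ ∑_{n ≤ N} a_n n^{it}` is continuous. [folklore] -/
theorem continuous_dirichletPoly (N : ℕ) (a : ℕ → ℂ) :
    Continuous fun t : ℝ => ∑ n ∈ Finset.Icc 1 N, a n * (n : ℂ) ^ ((t : ℂ) * I) := by
  refine continuous_finsetSum _ fun n hn => continuous_const.mul ?_
  exact continuous_natCast_cpow_mul_I (by have := (Finset.mem_Icc.1 hn).1; omega)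

/-- The mean value theorem on an arbitrary interval:
`|∫_{T₁}^{T₂} |∑ a_n n^{it}|² dt − (T₂ − T₁) ∑ |a_n|²| ≤ 1856 ∑ n |a_n|²`. [cite: Ivic1985, Theorem 5.2] -/
theorem abs_integral_norm_sq_dirichletPoly_sub_le (N : ℕ) (a : ℕ → ℂ) (T₁ T₂ : ℝ) :
    |(∫ t in T₁..T₂, ‖∑ n ∈ Finset.Icc 1 N, a n * (n : ℂ) ^ ((t : ℂ) * I)‖ ^ 2)
        - (T₂ - T₁) * ∑ n ∈ Finset.Icc 1 N, ‖a n‖ ^ 2|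
      ≤ 1856 * ∑ n ∈ Finset.Icc 1 N, (n : ℝ) * ‖a n‖ ^ 2 := by
  have hcont : Continuous fun t : ℝ => ‖∑ n ∈ Finset.Icc 1 N, a n * (n : ℂ) ^ ((t : ℂ) * I)‖ ^ 2 :=
    ((continuous_dirichletPoly N a).norm).pow 2
  have hsplit : (∫ t in T₁..T₂, ‖∑ n ∈ Finset.Icc 1 N, a n * (n : ℂ) ^ ((t : ℂ) * I)‖ ^ 2) =
      (∫ t in (0 : ℝ)..T₂, ‖∑ n ∈ Finset.Icc 1 N, a n * (n : ℂ) ^ ((t : ℂ) * I)‖ ^ 2) -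
        ∫ t in (0 : ℝ)..T₁, ‖∑ n ∈ Finset.Icc 1 N, a n * (n : ℂ) ^ ((t : ℂ) * I)‖ ^ 2 :=
    (intervalIntegral.integral_interval_sub_left (hcont.intervalIntegrable _ _)
      (hcont.intervalIntegrable _ _)).symm
  have h1 := integral_norm_sq_dirichletPoly_sub_le N a T₁
  have h2 := integral_norm_sq_dirichletPoly_sub_le N a T₂
  rw [hsplit, abs_le] at *
  constructor <;> nlinarith [h1.1, h1.2, h2.1, h2.2]

/-- **Bilinear mean value theorem for Dirichlet polynomials** (polarised Montgomery–Vaughan):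
`‖∫_{T₁}^{T₂} (∑ a_n n^{it}) conj(∑ b_n n^{it}) dt − (T₂ − T₁) ∑ a_n b̄_n‖ ≤ 3712 ∑ n (|a_n|² + |b_n|²)`.
[cite: Ivic1985, Theorem 5.2] -/
theorem norm_integral_dirichletPoly_mul_conj_sub_le (N : ℕ) (a b : ℕ → ℂ) (T₁ T₂ : ℝ) :
    ‖(∫ t in T₁..T₂, (∑ n ∈ Finset.Icc 1 N, a n * (n : ℂ) ^ ((t : ℂ) * I)) *
          conj (∑ n ∈ Finset.Icc 1 N, b n * (n : ℂ) ^ ((t : ℂ) * I)))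
        - (T₂ - T₁) * ∑ n ∈ Finset.Icc 1 N, a n * conj (b n)‖
      ≤ 3712 * ∑ n ∈ Finset.Icc 1 N, (n : ℝ) * (‖a n‖ ^ 2 + ‖b n‖ ^ 2) := by
  -- the four polarised coefficient vectors
  set c : ℂ → ℕ → ℂ := fun w n => a n + w * b n with hc
  set D : (ℕ → ℂ) → ℝ → ℂ := fun e t => ∑ n ∈ Finset.Icc 1 N, e n * (n : ℂ) ^ ((t : ℂ) * I) with hD
  set Q : ℂ → ℝ := fun w => (∫ t in T₁..T₂, ‖D (c w) t‖ ^ 2) - (T₂ - T₁) * ∑ n ∈ Finset.Icc 1 N, ‖c w n‖ ^ 2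
    with hQ
  -- pointwise polarisation of the integrand and of the diagonal
  have hDlin : ∀ w t, D (c w) t = D a t + w * D b t := by
    intro w t
    simp only [hD, hc, Finset.mul_sum, ← Finset.sum_add_distrib]
    refine Finset.sum_congr rfl fun n _ => by ring
  have hpol_t : ∀ t, 4 * (D a t * conj (D b t)) =
      ((‖D (c 1) t‖ ^ 2 : ℝ) : ℂ) - ((‖D (c (-1)) t‖ ^ 2 : ℝ) : ℂ)
        + I * ((‖D (c I) t‖ ^ 2 : ℝ) : ℂ) - I * ((‖D (c (-I)) t‖ ^ 2 : ℝ) : ℂ) := by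
    intro t
    rw [four_mul_mul_conj_eq_polarisation, hDlin, hDlin, hDlin, hDlin]
    ring_nf
  have hpol_n : ∀ n, 4 * (a n * conj (b n)) =
      ((‖c 1 n‖ ^ 2 : ℝ) : ℂ) - ((‖c (-1) n‖ ^ 2 : ℝ) : ℂ)
        + I * ((‖c I n‖ ^ 2 : ℝ) : ℂ) - I * ((‖c (-I) n‖ ^ 2 : ℝ) : ℂ) := by
    intro n
    rw [four_mul_mul_conj_eq_polarisation]
    simp only [hc]
    ring_nf
  -- integrability
  have hcontD : ∀ e : ℕ → ℂ, Continuous (D e) := fun e => by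
    simp only [hD]; exact continuous_dirichletPoly N e
  have hint_sq : ∀ w, IntervalIntegrable (fun t => (((‖D (c w) t‖ ^ 2 : ℝ) : ℂ))) volume T₁ T₂ :=
    fun w => (Complex.continuous_ofReal.comp (((hcontD (c w)).norm).pow 2)).intervalIntegrable _ _
  -- `4 (∫ D_a conj D_b − (T₂−T₁) Σ a b̄) = Q(1) − Q(−1) + i Q(i) − i Q(−i)`
  have hmain : 4 * ((∫ t in T₁..T₂, D a t * conj (D b t)) - (T₂ - T₁) * ∑ n ∈ Finset.Icc 1 N, a n * conj (b n))
      = (Q 1 : ℂ) - Q (-1) + I * Q I - I * Q (-I) := by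
    have hI4 : 4 * (∫ t in T₁..T₂, D a t * conj (D b t)) =
        (∫ t in T₁..T₂, (((‖D (c 1) t‖ ^ 2 : ℝ) : ℂ))) - (∫ t in T₁..T₂, (((‖D (c (-1)) t‖ ^ 2 : ℝ) : ℂ)))
        + I * (∫ t in T₁..T₂, (((‖D (c I) t‖ ^ 2 : ℝ) : ℂ)))
        - I * (∫ t in T₁..T₂, (((‖D (c (-I)) t‖ ^ 2 : ℝ) : ℂ))) := by
      rw [← intervalIntegral.integral_const_mul, intervalIntegral.integral_congr fun t _ => hpol_t t,
        intervalIntegral.integral_sub, intervalIntegral.integral_add, intervalIntegral.integral_sub,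
        intervalIntegral.integral_const_mul, intervalIntegral.integral_const_mul]
      · exact hint_sq 1
      · exact hint_sq (-1)
      · exact (hint_sq 1).sub (hint_sq (-1))
      · exact (hint_sq I).const_mul I
      · exact ((hint_sq 1).sub (hint_sq (-1))).add ((hint_sq I).const_mul I)
      · exact (hint_sq (-I)).const_mul I
    have hS4 : 4 * ∑ n ∈ Finset.Icc 1 N, a n * conj (b n) =
        (∑ n ∈ Finset.Icc 1 N, (((‖c 1 n‖ ^ 2 : ℝ) : ℂ))) - (∑ n ∈ Finset.Icc 1 N, (((‖c (-1) n‖ ^ 2 : ℝ) : ℂ)))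
        + I * (∑ n ∈ Finset.Icc 1 N, (((‖c I n‖ ^ 2 : ℝ) : ℂ)))
        - I * (∑ n ∈ Finset.Icc 1 N, (((‖c (-I) n‖ ^ 2 : ℝ) : ℂ))) := by
      rw [Finset.mul_sum, Finset.sum_congr rfl fun n _ => hpol_n n, Finset.sum_sub_distrib,
        Finset.sum_add_distrib, Finset.sum_sub_distrib, Finset.mul_sum, Finset.mul_sum]
    have hQw : ∀ w, (Q w : ℂ) = (∫ t in T₁..T₂, (((‖D (c w) t‖ ^ 2 : ℝ) : ℂ))) -
        (T₂ - T₁ : ℝ) * ∑ n ∈ Finset.Icc 1 N, (((‖c w n‖ ^ 2 : ℝ) : ℂ)) := by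
      intro w
      simp only [hQ]
      rw [intervalIntegral.integral_ofReal]
      push_cast
      rfl
    rw [mul_sub, hI4, mul_left_comm, hS4, hQw, hQw, hQw, hQw]
    push_cast
    ring
  -- each `|Q w| ≤ 1856 Σ n |c_w n|² ≤ 3712 Σ n (|a|² + |b|²)` for `|w| = 1`
  have hQb : ∀ w : ℂ, ‖w‖ = 1 → |Q w| ≤ 3712 * ∑ n ∈ Finset.Icc 1 N, (n : ℝ) * (‖a n‖ ^ 2 + ‖b n‖ ^ 2) := by
    intro w hw
    have h := abs_integral_norm_sq_dirichletPoly_sub_le N (c w) T₁ T₂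
    refine h.trans ?_
    have hterm : ∀ n ∈ Finset.Icc 1 N, (n : ℝ) * ‖c w n‖ ^ 2 ≤ 2 * ((n : ℝ) * (‖a n‖ ^ 2 + ‖b n‖ ^ 2)) := by
      intro n _
      have hn0 : (0 : ℝ) ≤ n := Nat.cast_nonneg n
      have hcn : ‖c w n‖ ^ 2 ≤ 2 * (‖a n‖ ^ 2 + ‖b n‖ ^ 2) := by
        have h1 : ‖c w n‖ ≤ ‖a n‖ + ‖b n‖ := by
          simp only [hc]
          calc ‖a n + w * b n‖ ≤ ‖a n‖ + ‖w * b n‖ := norm_add_le _ _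
            _ = ‖a n‖ + ‖b n‖ := by rw [norm_mul, hw, one_mul]
        have h2 : ‖c w n‖ ^ 2 ≤ (‖a n‖ + ‖b n‖) ^ 2 := pow_le_pow_left₀ (norm_nonneg _) h1 2
        nlinarith [sq_nonneg (‖a n‖ - ‖b n‖)]
      nlinarith
    calc 1856 * ∑ n ∈ Finset.Icc 1 N, (n : ℝ) * ‖c w n‖ ^ 2
        ≤ 1856 * ∑ n ∈ Finset.Icc 1 N, 2 * ((n : ℝ) * (‖a n‖ ^ 2 + ‖b n‖ ^ 2)) :=
          mul_le_mul_of_nonneg_left (Finset.sum_le_sum hterm) (by norm_num)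
      _ = 3712 * ∑ n ∈ Finset.Icc 1 N, (n : ℝ) * (‖a n‖ ^ 2 + ‖b n‖ ^ 2) := by
          rw [← Finset.mul_sum]; ring
  have h1 := hQb 1 (by simp)
  have h2 := hQb (-1) (by simp)
  have h3 := hQb I (by simp)
  have h4 := hQb (-I) (by simp)
  -- conclude
  have hnorm4 : ‖(4 : ℂ) * ((∫ t in T₁..T₂, D a t * conj (D b t)) -
      (T₂ - T₁) * ∑ n ∈ Finset.Icc 1 N, a n * conj (b n))‖ ≤
      4 * (3712 * ∑ n ∈ Finset.Icc 1 N, (n : ℝ) * (‖a n‖ ^ 2 + ‖b n‖ ^ 2)) := by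
    rw [hmain]
    have hI : ‖I‖ = 1 := Complex.norm_I
    calc ‖(Q 1 : ℂ) - Q (-1) + I * Q I - I * Q (-I)‖
        ≤ ‖(Q 1 : ℂ)‖ + ‖(Q (-1) : ℂ)‖ + ‖I * Q I‖ + ‖I * Q (-I)‖ := by
          refine (norm_sub_le _ _).trans (add_le_add ((norm_add_le _ _).trans (add_le_add
            (norm_sub_le _ _) le_rfl)) le_rfl)
      _ = |Q 1| + |Q (-1)| + |Q I| + |Q (-I)| := by
          simp only [norm_mul, hI, one_mul, Complex.norm_real, Real.norm_eq_abs]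
      _ ≤ _ := by linarith
  have h4eq : ‖(4 : ℂ) * ((∫ t in T₁..T₂, D a t * conj (D b t)) -
      (T₂ - T₁) * ∑ n ∈ Finset.Icc 1 N, a n * conj (b n))‖ =
      4 * ‖(∫ t in T₁..T₂, D a t * conj (D b t)) -
        (T₂ - T₁) * ∑ n ∈ Finset.Icc 1 N, a n * conj (b n)‖ := by
    rw [norm_mul]; norm_num
  rw [h4eq] at hnorm4
  have := le_of_mul_le_mul_left hnorm4 (by norm_num : (0:ℝ) < 4)
  simpa only [hD] using this

end Literature.NumberTheory.LFunctions
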